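import Literature.Computability.AlgebraicComplexity.GenericFormsNonsingular
import Literature.Computability.AlgebraicComplexity.ApolarityAction
import Mathlib.LinearAlgebra.Matrix.SchurComplement
import Mathlib.LinearAlgebra.Matrix.Permutation
import Mathlib.LinearAlgebra.Matrix.ToLinearEquiv
import Mathlib.LinearAlgebra.Matrix.NonsingularInverse
import HarnessLib

/-!
# The singular forms of degree `D` are an irreducible Zariski-closed family (the discriminant locus, I)

Topic `Literature/Computability/AlgebraicComplexity` (cell `val-lit`, row BI2017-A: brick (3) of the
Mumford route to `BI2017_prop_2_10` — "the discriminant exists"; companion of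
`GenericFormsNonsingular.lean`). Classical background: the forms `F ∈ Sym^D ℂ^m` defining a
SINGULAR hypersurface (a common zero `z ≠ 0` of `F, ∂₀F, …, ∂_{m-1}F`) are the points of an
irreducible hypersurface of `Sym^D`, the discriminant locus (Gelfand–Kapranov–Zelevinsky,
*Discriminants, resultants and multidimensional determinants*, Ch. 1; Mumford–Fogarty–Kirwan,
GIT, Prop. 4.2 uses its equation, the discriminant, an `SL_m`-invariant). This file proves the
first half, with no resultants:

* `singBaseForm c` — the general form of degree `D` SINGULAR AT THE POINT `e₀ = (1, 0, …, 0)`: the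
  forms without the monomials `x₀^D`, `x₀^{D-1} x_j` (coefficients indexed by the degree-`D`
  exponents `e` with `e 0 + 2 ≤ D`);
* `singFamilyCoeff` — the coefficients of `A · (singBaseForm c)` as polynomials in the matrix
  entries of `A` and in `c` (a polynomial map from an AFFINE SPACE onto the singular forms: every
  matrix `A`, invertible or not, is allowed — a degenerate substitution produces a cone, which is
  singular);
* `not_isNonsingularForm_linSubst_singBaseForm` / `exists_eq_linSubst_singBaseForm` — its image is
  EXACTLY the set of singular forms of degree `D` (`D ≥ 2`, over `ℂ`);
* `forall_singular_aeval_eq_zero_iff` — a polynomial function on `Sym^D` vanishes on all singular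
  forms iff it lies in the kernel of the comorphism `Φ ↦ Φ(singFamilyCoeff)`; hence
* `isPrime_ker_singFamily`, `ker_singFamily_ne_bot` — **the ideal `I_S` of the singular locus is a
  NON-ZERO PRIME** of `ℂ[Sym^D ℂ^m]` (non-zero by the tree's genericity of smoothness,
  `isZariskiGeneric_isNonsingularForm`, seat p4).

The second half (height one ⇒ principal ⇒ the discriminant `Δ₀`, and its `SL_m`-invariance) is in
the sibling files. Honest framing: classical algebraic geometry; typed ≠ endorsed; nothing here
bears on `VP ≠ VNP`.

## References

* I. M. Gelfand, M. M. Kapranov, A. V. Zelevinsky, *Discriminants, Resultants, and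
  Multidimensional Determinants*, Birkhäuser 1994, Ch. 1 §1 (the discriminant hypersurface).
* D. Mumford, J. Fogarty, F. Kirwan, *Geometric Invariant Theory*, 3rd ed., Prop. 4.2.
* [BurgisserIkenmeyer2017] P. Bürgisser, C. Ikenmeyer, J. Algebra 477 (2017), Prop. 2.10 (consumer).
-/

noncomputable section

open MvPolynomial Matrix

namespace Literature.Computability.AlgebraicComplexity

open Literature.AlgebraicGeometry.Motives.SmoothHypersurface

namespace FormDiscriminant

variable {n D : ℕ}

/-! ### Exponent bookkeeping around `e₀ = (1, 0, …, 0)` -/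

section Exponents

/-- The degree of an exponent vector on `Fin (n+2)` splits off the `x₀`-exponent. [folklore] -/
private theorem degree_eq_apply_zero_add (s : Fin (n + 2) →₀ ℕ) :
    s.degree = s 0 + ∑ k : Fin (n + 1), s k.succ := by
  rw [Finsupp.degree_eq_sum, Fin.sum_univ_succ]

/-- An exponent vector without variables other than `x₀` is a power of `x₀`. [folklore] -/
private theorem eq_single_zero_of_forall (s : Fin (n + 2) →₀ ℕ) (h : ∀ i : Fin (n + 2), i ≠ 0 → s i = 0) :
    s = Finsupp.single 0 (s.degree) := by
  classical
  have hdeg : s.degree = s 0 := by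
    rw [degree_eq_apply_zero_add, Finset.sum_eq_zero fun k _ => h _ (Fin.succ_ne_zero k), add_zero]
  ext i
  by_cases hi : i = 0
  · subst hi; rw [Finsupp.single_eq_same, hdeg]
  · rw [Finsupp.single_eq_of_ne hi, h i hi]

/-- A "free" exponent (`e₀ + 2 ≤ D`, degree `D`) still involves a variable other than `x₀` after one
`x_j` is removed. [folklore] -/
private theorem exists_ne_zero_apply_sub_single {e : Fin (n + 2) →₀ ℕ} (he : e.degree = D)
    (hfree : e 0 + 2 ≤ D) (j : Fin (n + 2)) :
    ∃ i : Fin (n + 2), i ≠ 0 ∧ (e - Finsupp.single j (1 : ℕ) : Fin (n + 2) →₀ ℕ) i ≠ 0 := by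
  classical
  by_contra hcon
  push Not at hcon
  have hle : ∀ k : Fin (n + 1),
      e k.succ ≤ (Finsupp.single j (1 : ℕ) : Fin (n + 2) →₀ ℕ) k.succ := by
    intro k
    have := hcon k.succ (Fin.succ_ne_zero k)
    rw [Finsupp.tsub_apply] at this
    omega
  have h1 : (Finsupp.single j (1 : ℕ) : Fin (n + 2) →₀ ℕ).degree = 1 := Finsupp.degree_single j 1
  rw [degree_eq_apply_zero_add] at h1
  have h2 := degree_eq_apply_zero_add e
  rw [he] at h2
  have h3 : ∑ k : Fin (n + 1), e k.succ ≤
      ∑ k : Fin (n + 1), (Finsupp.single j (1 : ℕ) : Fin (n + 2) →₀ ℕ) k.succ :=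
    Finset.sum_le_sum fun k _ => hle k
  omega

end Exponents

/-! ### Forms singular at `e₀` -/

section Base

variable (R : Type*) [CommRing R]

/-- The general form of degree `D` in `x₀, …, x_{n+1}` that is **singular at `e₀ = (1,0,…,0)`**:
`Σ_{e : deg e = D, e₀ + 2 ≤ D} c_e x^e` — no monomials `x₀^D`, `x₀^{D-1}x_j` (those are exactly the
monomials whose value or gradient at `e₀` is non-zero); Mumford's "`F` has a singular point at
`(1,0,…,0)`" coordinates. [cite: MumfordFogartyKirwan1994, Ch. 4 §2, Prop. 4.2 (proof: singular point at (1,0,…,0))] -/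
def singBaseForm (c : DegIdx (Fin (n + 2)) D → R) : MvPolynomial (Fin (n + 2)) R :=
  ∑ e : DegIdx (Fin (n + 2)) D, if e.1 0 + 2 ≤ D then monomial e.1 (c e) else 0

variable {R}

/-- `singBaseForm c` is a form of degree `D`. [cite: MumfordFogartyKirwan1994, Ch. 4 §2, Prop. 4.2 (proof: singular point at (1,0,…,0))] -/
theorem isHomogeneous_singBaseForm (c : DegIdx (Fin (n + 2)) D → R) :
    (singBaseForm R c).IsHomogeneous D := by
  classical
  unfold singBaseForm
  refine IsHomogeneous.sum _ _ _ fun e _ => ?_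
  split_ifs
  · exact isHomogeneous_monomial _ (mem_degMonomials_iff.1 e.2)
  · exact isHomogeneous_zero _ _ _

/-- The coefficients of `singBaseForm c`: `c_e` at a free exponent of degree `D`, `0` elsewhere.
[cite: MumfordFogartyKirwan1994, Ch. 4 §2, Prop. 4.2 (proof: singular point at (1,0,…,0))] -/
theorem coeff_singBaseForm (c : DegIdx (Fin (n + 2)) D → R) (d : Fin (n + 2) →₀ ℕ) :
    coeff d (singBaseForm R c) =
      if h : d.degree = D then (if d 0 + 2 ≤ D then c ⟨d, mem_degMonomials_iff.2 h⟩ else 0)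
      else 0 := by
  classical
  unfold singBaseForm
  rw [coeff_sum]
  by_cases h : d.degree = D
  · rw [dif_pos h, Finset.sum_eq_single ⟨d, mem_degMonomials_iff.2 h⟩]
    · simp only
      split_ifs
      · rw [coeff_monomial, if_pos rfl]
      · rw [coeff_zero]
    · intro e _ hne
      have hne' : e.1 ≠ d := fun h' => hne (Subtype.ext h')
      split_ifs
      · rw [coeff_monomial, if_neg hne']
      · exact coeff_zero _
    · intro h'; exact absurd (Finset.mem_univ _) h'
  · rw [dif_neg h]
    refine Finset.sum_eq_zero fun e _ => ?_
    split_ifs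
    · rw [coeff_monomial, if_neg]
      intro h'
      exact h (h' ▸ mem_degMonomials_iff.1 e.2)
    · exact coeff_zero _

/-- Base change: a ring map acts on `singBaseForm c` through the coefficients. [cite: MumfordFogartyKirwan1994, Ch. 4 §2, Prop. 4.2 (proof: singular point at (1,0,…,0))] -/
theorem map_singBaseForm {S : Type*} [CommRing S] (φ : R →+* S)
    (c : DegIdx (Fin (n + 2)) D → R) :
    MvPolynomial.map φ (singBaseForm R c) = singBaseForm S (φ ∘ c) := by
  unfold singBaseForm
  rw [map_sum]
  refine Finset.sum_congr rfl fun e _ => ?_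
  split_ifs
  · rw [map_monomial]; rfl
  · exact map_zero _

end Base

/-! ### Evaluation at `e₀` and at `0`; linear substitutions -/

section Eval

variable {R : Type*} [CommRing R]

/-- A monomial with a variable other than `x₀` vanishes at `e₀ = (1, 0, …, 0)`. [folklore] -/
private theorem eval_single_monomial_eq_zero {s : Fin (n + 2) →₀ ℕ} {i : Fin (n + 2)} (hi : i ≠ 0)
    (hs : s i ≠ 0) (a : R) : eval (Pi.single (0 : Fin (n + 2)) (1 : R)) (monomial s a) = 0 := by
  classical
  rw [eval_monomial, Finsupp.prod]
  have hmem : i ∈ s.support := Finsupp.mem_support_iff.2 hs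
  rw [Finset.prod_eq_zero hmem, mul_zero]
  rw [Pi.single_eq_of_ne hi, zero_pow hs]

/-- A monomial in `x₀` alone takes the value of its coefficient at `e₀`. [folklore] -/
private theorem eval_single_monomial_of_forall {s : Fin (n + 2) →₀ ℕ}
    (h : ∀ i : Fin (n + 2), i ≠ 0 → s i = 0) (a : R) :
    eval (Pi.single (0 : Fin (n + 2)) (1 : R)) (monomial s a) = a := by
  classical
  rw [eq_single_zero_of_forall s h, eval_monomial]
  simp [Finsupp.prod_single_index]

/-- `singBaseForm c` vanishes at `e₀`. [cite: MumfordFogartyKirwan1994, Ch. 4 §2, Prop. 4.2 (proof: singular point at (1,0,…,0))] -/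
theorem eval_single_singBaseForm (c : DegIdx (Fin (n + 2)) D → R) :
    eval (Pi.single (0 : Fin (n + 2)) (1 : R)) (singBaseForm R c) = 0 := by
  classical
  unfold singBaseForm
  rw [map_sum]
  refine Finset.sum_eq_zero fun e _ => ?_
  split_ifs with hfree
  · obtain ⟨i, hi, hei⟩ := exists_ne_zero_apply_sub_single (mem_degMonomials_iff.1 e.2) hfree 0
    have hei' : e.1 i ≠ 0 := by
      rw [Finsupp.tsub_apply, Finsupp.single_eq_of_ne hi] at hei
      simpa using hei
    exact eval_single_monomial_eq_zero hi hei' _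
  · exact map_zero _

/-- The partial derivatives of `singBaseForm c` vanish at `e₀`. [cite: MumfordFogartyKirwan1994, Ch. 4 §2, Prop. 4.2 (proof: singular point at (1,0,…,0))] -/
theorem eval_single_pderiv_singBaseForm (c : DegIdx (Fin (n + 2)) D → R) (j : Fin (n + 2)) :
    eval (Pi.single (0 : Fin (n + 2)) (1 : R)) (pderiv j (singBaseForm R c)) = 0 := by
  classical
  unfold singBaseForm
  rw [map_sum, map_sum]
  refine Finset.sum_eq_zero fun e _ => ?_
  split_ifs with hfree
  · rw [pderiv_monomial]
    obtain ⟨i, hi, hei⟩ := exists_ne_zero_apply_sub_single (mem_degMonomials_iff.1 e.2) hfree j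
    exact eval_single_monomial_eq_zero hi hei _
  · rw [map_zero, map_zero]

/-- A form of positive degree vanishes at the origin. [folklore] -/
private theorem eval_zero_of_isHomogeneous {σ : Type*} {F : MvPolynomial σ R} {d : ℕ}
    (hF : F.IsHomogeneous d) (hd : 1 ≤ d) : eval (0 : σ → R) F = 0 := by
  have h0 : (fun _ : σ => (0 : R)) = (0 : σ → R) := rfl
  rw [← h0, eval_zero', constantCoeff_eq]
  refine hF.coeff_eq_zero ?_
  rw [map_zero]
  omega

/-- `(A · f)(x) = f(Aᵀ x)` for the tree's `linSubst` (`x_i ↦ Σ_j A_{ji} x_j`). [cite: Landsberg2017, §1.2] -/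
theorem eval_linSubst_eq {m : ℕ} (M : Matrix (Fin m) (Fin m) R) (x : Fin m → R)
    (f : MvPolynomial (Fin m) R) : eval x (linSubst (Fin m) R M f) = eval (Mᵀ *ᵥ x) f := by
  induction f using MvPolynomial.induction_on with
  | C a => rw [linSubst_C, eval_C, eval_C]
  | add p q hp hq => rw [map_add, map_add, map_add, hp, hq]
  | mul_X p i hp =>
    rw [map_mul, map_mul, map_mul, hp, linSubst_X, eval_X]
    congr 1
    simp [mulVec, dotProduct, smul_eval]

/-- The value of a form of degree `D` at `e₀` is its `x₀^D`-coefficient. [cite: MumfordFogartyKirwan1994, Ch. 4 §2, Prop. 4.2 (proof: singular point at (1,0,…,0))] -/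
theorem eval_single_eq_coeff {F : MvPolynomial (Fin (n + 2)) R} (hF : F.IsHomogeneous D) :
    eval (Pi.single (0 : Fin (n + 2)) (1 : R)) F = coeff (Finsupp.single 0 D) F := by
  classical
  conv_lhs => rw [F.as_sum, map_sum]
  rw [Finset.sum_eq_single (Finsupp.single 0 D)]
  · exact eval_single_monomial_of_forall (fun i hi => Finsupp.single_eq_of_ne hi) _
  · intro e he hne
    have hdeg : e.degree = D := by
      rw [Finsupp.degree_eq_weight_one]; exact hF (mem_support_iff.1 he)
    -- `e ≠ single 0 D` of degree `D` has a coordinate `i ≠ 0`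
    obtain ⟨i, hi, hei⟩ : ∃ i : Fin (n + 2), i ≠ 0 ∧ e i ≠ 0 := by
      by_contra hcon
      push Not at hcon
      exact hne (hdeg ▸ eq_single_zero_of_forall e hcon)
    exact eval_single_monomial_eq_zero hi hei _
  · intro h
    simp [notMem_support_iff.1 h]

/-- The gradient of a form of degree `D ≥ 1` at `e₀` reads off the `x₀^{D-1} x_j`-coefficients:
`(∂_j F)(e₀) = s_j · coeff_s F` with `s = (D-1)·e₀ + e_j`. [cite: MumfordFogartyKirwan1994, Ch. 4 §2, Prop. 4.2 (proof: singular point at (1,0,…,0))] -/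
theorem eval_single_pderiv_eq_coeff {F : MvPolynomial (Fin (n + 2)) R} (hF : F.IsHomogeneous D)
    (hD : 1 ≤ D) (j : Fin (n + 2)) :
    eval (Pi.single (0 : Fin (n + 2)) (1 : R)) (pderiv j F) =
      ((Finsupp.single 0 (D - 1) + Finsupp.single j 1 : Fin (n + 2) →₀ ℕ) j : R) *
        coeff (Finsupp.single 0 (D - 1) + Finsupp.single j 1) F := by
  classical
  set s₀ : Fin (n + 2) →₀ ℕ := Finsupp.single 0 (D - 1) + Finsupp.single j 1 with hs₀_def
  conv_lhs => rw [F.as_sum, map_sum, map_sum]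
  rw [Finset.sum_eq_single s₀]
  · rw [pderiv_monomial]
    have hsub : s₀ - Finsupp.single j 1 = Finsupp.single 0 (D - 1) := by
      rw [hs₀_def, add_tsub_cancel_right]
    rw [hsub, eval_single_monomial_of_forall (fun i hi => Finsupp.single_eq_of_ne hi), mul_comm]
  · intro e he hne
    rw [pderiv_monomial]
    by_cases hej : e j = 0
    · simp [hej]
    have hdeg : e.degree = D := by
      rw [Finsupp.degree_eq_weight_one]; exact hF (mem_support_iff.1 he)
    -- `e - single j 1` has a coordinate `i ≠ 0`, else `e = s₀`
    obtain ⟨i, hi, hei⟩ : ∃ i : Fin (n + 2), i ≠ 0 ∧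
        (e - Finsupp.single j (1 : ℕ) : Fin (n + 2) →₀ ℕ) i ≠ 0 := by
      by_contra hcon
      push Not at hcon
      apply hne
      have hsplit : e = (e - Finsupp.single j (1 : ℕ)) + Finsupp.single j 1 := by
        rw [tsub_add_cancel_of_le]
        exact Finsupp.single_le_iff.2 (Nat.one_le_iff_ne_zero.2 hej)
      have hrest := eq_single_zero_of_forall _ hcon
      have hdeg' : (e - Finsupp.single j (1 : ℕ) : Fin (n + 2) →₀ ℕ).degree + 1 = D := by
        have := congrArg Finsupp.degree hsplit
        rw [map_add, Finsupp.degree_single] at this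
        omega
      rw [hsplit, hrest, hs₀_def]
      congr 2
      omega
    exact eval_single_monomial_eq_zero hi hei _
  · intro h
    simp [notMem_support_iff.1 h]

end Eval

/-! ### The image of the singular family consists of singular forms -/

section Image

/-- **Every member of the family is singular**: for every matrix `A` (invertible or not) and every
coefficient vector `c`, the form `A · singBaseForm c` of degree `D ≥ 2` is NOT nonsingular — if
`Aᵀ` kills a vector `z ≠ 0` the form is a cone with vertex `z`; otherwise `Aᵀ z = e₀` for some
`z ≠ 0` and `z` is a singular point. [cite: MumfordFogartyKirwan1994, Ch. 4 §2, Prop. 4.2 (proof: singular point at (1,0,…,0))] -/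
theorem not_isNonsingularForm_linSubst_singBaseForm (hD : 2 ≤ D)
    (A : Matrix (Fin (n + 2)) (Fin (n + 2)) ℂ) (c : DegIdx (Fin (n + 2)) D → ℂ) :
    ¬ IsNonsingularForm ℂ (linSubst (Fin (n + 2)) ℂ A (singBaseForm ℂ c)) := by
  classical
  intro hns
  set F := singBaseForm ℂ c with hF_def
  have hF : F.IsHomogeneous D := isHomogeneous_singBaseForm c
  -- a point `z ≠ 0` with `Aᵀ z ∈ {0, e₀}`
  obtain ⟨z, hz, hAz⟩ : ∃ z : Fin (n + 2) → ℂ, z ≠ 0 ∧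
      (Aᵀ *ᵥ z = 0 ∨ Aᵀ *ᵥ z = Pi.single (0 : Fin (n + 2)) (1 : ℂ)) := by
    by_cases hdet : Aᵀ.det = 0
    · obtain ⟨z, hz, hAz⟩ := Matrix.exists_mulVec_eq_zero_iff.2 hdet
      exact ⟨z, hz, Or.inl hAz⟩
    · have hunit : IsUnit Aᵀ.det := Ne.isUnit hdet
      refine ⟨Aᵀ⁻¹ *ᵥ Pi.single (0 : Fin (n + 2)) (1 : ℂ), ?_, Or.inr ?_⟩
      · intro h0
        have h1 : Aᵀ *ᵥ (Aᵀ⁻¹ *ᵥ Pi.single (0 : Fin (n + 2)) (1 : ℂ)) = 0 := by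
          rw [h0, Matrix.mulVec_zero]
        rw [Matrix.mulVec_mulVec, Matrix.mul_nonsing_inv _ hunit, Matrix.one_mulVec] at h1
        have h2 := congr_fun h1 0
        rw [Pi.single_eq_same, Pi.zero_apply] at h2
        exact one_ne_zero h2
      · rw [Matrix.mulVec_mulVec, Matrix.mul_nonsing_inv _ hunit, Matrix.one_mulVec]
  -- a form of positive degree vanishing at `e₀` vanishes at `Aᵀ z`
  have hval : ∀ G : MvPolynomial (Fin (n + 2)) ℂ, ∀ d : ℕ, 1 ≤ d → G.IsHomogeneous d →
      eval (Pi.single (0 : Fin (n + 2)) (1 : ℂ)) G = 0 → eval (Aᵀ *ᵥ z) G = 0 := by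
    intro G d hd hG hGe
    rcases hAz with h | h
    · rw [h]; exact eval_zero_of_isHomogeneous hG hd
    · rw [h]; exact hGe
  have hz0 : eval z (linSubst (Fin (n + 2)) ℂ A F) = 0 := by
    rw [eval_linSubst_eq]
    exact hval F D (by omega) hF (eval_single_singBaseForm c)
  obtain ⟨j, hj⟩ := (isNonsingularForm_iff_forall_exists_eval_pderiv_ne_zero.1 hns) z hz hz0
  apply hj
  rw [pderiv_linSubst_eq_sum, map_sum]
  refine Finset.sum_eq_zero fun l _ => ?_
  rw [smul_eval, eval_linSubst_eq, hval (pderiv l F) (D - 1) (by omega) hF.pderiv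
    (eval_single_pderiv_singBaseForm c l), mul_zero]

/-- A form of degree `D ≥ 1` singular at `e₀` (value and gradient zero there, over `ℂ`) has no
monomials `x₀^D`, `x₀^{D-1}x_j`: it is `singBaseForm` of its own coefficients. [cite: MumfordFogartyKirwan1994, Ch. 4 §2, Prop. 4.2 (proof: singular point at (1,0,…,0))] -/
theorem eq_singBaseForm_of_singular_at_single {F : MvPolynomial (Fin (n + 2)) ℂ}
    (hF : F.IsHomogeneous D) (hD : 1 ≤ D)
    (h0 : eval (Pi.single (0 : Fin (n + 2)) (1 : ℂ)) F = 0)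
    (h1 : ∀ j, eval (Pi.single (0 : Fin (n + 2)) (1 : ℂ)) (pderiv j F) = 0) :
    F = singBaseForm ℂ (formCoeff D F) := by
  classical
  apply MvPolynomial.ext
  intro d
  rw [coeff_singBaseForm]
  by_cases hd : d.degree = D
  · rw [dif_pos hd]
    split_ifs with hfree
    · rfl
    · -- an excluded exponent: `d 0 = D` or `d 0 = D - 1`
      have hsum := degree_eq_apply_zero_add d
      rw [hd] at hsum
      rcases Nat.lt_or_ge (d 0) D with hlt | hge
      · -- `d 0 = D - 1`: exactly one `k` with `d k.succ = 1`
        have hrest : ∑ k : Fin (n + 1), d k.succ = 1 := by omega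
        obtain ⟨k₀, hk₀⟩ : ∃ k₀ : Fin (n + 1), d k₀.succ ≠ 0 := by
          by_contra hcon
          push Not at hcon
          rw [Finset.sum_eq_zero fun i _ => hcon i] at hrest
          exact zero_ne_one hrest
        have hk₀le := Finset.single_le_sum (fun i _ => Nat.zero_le (d (Fin.succ i)))
          (Finset.mem_univ k₀)
        have hk₀' : d k₀.succ = 1 := by omega
        have hothers : ∀ i : Fin (n + 1), i ≠ k₀ → d i.succ = 0 := by
          intro i hi
          have := Finset.add_le_sum (fun i _ => Nat.zero_le (d (Fin.succ i))) (Finset.mem_univ i)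
            (Finset.mem_univ k₀) hi
          omega
        have hdeq : d = Finsupp.single 0 (D - 1) + Finsupp.single k₀.succ 1 := by
          ext i
          rw [Finsupp.add_apply]
          by_cases hi : i = 0
          · subst hi
            rw [Finsupp.single_eq_same, Finsupp.single_eq_of_ne (Fin.succ_ne_zero k₀).symm]
            omega
          · obtain ⟨i', rfl⟩ := Fin.exists_succ_eq.2 hi
            rw [Finsupp.single_eq_of_ne (Fin.succ_ne_zero i')]
            by_cases hii : i' = k₀
            · subst hii; rw [Finsupp.single_eq_same, hk₀']
            · rw [Finsupp.single_eq_of_ne (fun h => hii (Fin.succ_injective _ h)),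
                hothers i' hii, add_zero]
        have := h1 k₀.succ
        rw [eval_single_pderiv_eq_coeff hF hD, ← hdeq] at this
        have hcoef : ((d k₀.succ : ℕ) : ℂ) ≠ 0 := by rw [hk₀']; simp
        exact (mul_eq_zero.1 this).resolve_left hcoef
      · -- `d 0 = D`: `d = single 0 D`
        have hzero : ∀ i : Fin (n + 2), i ≠ 0 → d i = 0 := by
          intro i hi
          obtain ⟨i', rfl⟩ := Fin.exists_succ_eq.2 hi
          have := Finset.single_le_sum (fun i _ => Nat.zero_le (d (Fin.succ i)))
            (Finset.mem_univ i')
          omega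
        have hdeq : d = Finsupp.single 0 D := hd ▸ eq_single_zero_of_forall d hzero
        rw [eval_single_eq_coeff hF, ← hdeq] at h0
        exact h0
  · rw [dif_neg hd]
    exact hF.coeff_eq_zero hd

/-- An invertible matrix whose `0`-th row is a prescribed non-zero vector `z`: with `z_i ≠ 0`, swap
the rows `0, i` of `1 + e_i (z - e_i)ᵀ` (determinant `± z_i`). [folklore] -/
private theorem exists_matrix_row_zero_eq {m : ℕ} (z : Fin (m + 1) → ℂ) (hz : z ≠ 0) :
    ∃ B : Matrix (Fin (m + 1)) (Fin (m + 1)) ℂ, IsUnit B.det ∧ ∀ k, B 0 k = z k := by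
  classical
  obtain ⟨i, hi⟩ : ∃ i, z i ≠ 0 := by
    by_contra h
    push Not at h
    exact hz (funext h)
  set u : Fin (m + 1) → ℂ := Pi.single i 1 with hu
  set v : Fin (m + 1) → ℂ := z - Pi.single i 1 with hv
  set M : Matrix (Fin (m + 1)) (Fin (m + 1)) ℂ := 1 + Matrix.vecMulVec u v with hM
  have hMdet : M.det = z i := by
    rw [hM, Matrix.vecMulVec_eq Unit, Matrix.det_one_add_replicateCol_mul_replicateRow]
    rw [hv, hu, dotProduct_comm, single_dotProduct, one_mul, Pi.sub_apply, Pi.single_eq_same]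
    ring
  have hMrow : ∀ k, M i k = z k := by
    intro k
    rw [hM, Matrix.add_apply, Matrix.vecMulVec_apply, hu, hv, Pi.single_eq_same, one_mul,
      Pi.sub_apply, Matrix.one_apply]
    by_cases hik : i = k
    · subst hik; rw [if_pos rfl, Pi.single_eq_same]; ring
    · rw [if_neg hik, Pi.single_eq_of_ne' hik]; ring
  refine ⟨(Equiv.swap (0 : Fin (m + 1)) i).permMatrix ℂ * M, ?_, fun k => ?_⟩
  · rw [Matrix.det_mul, Matrix.det_permutation, hMdet]
    refine IsUnit.mul ?_ (Ne.isUnit hi)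
    rcases Int.units_eq_one_or (Equiv.Perm.sign (Equiv.swap (0 : Fin (m + 1)) i)) with h | h <;>
      simp [h]
  · rw [Equiv.Perm.permMatrix, PEquiv.toMatrix_toPEquiv_mul, Matrix.submatrix_apply, id,
      Equiv.swap_apply_left, hMrow]

/-- **Every singular form is in the family**: a form `G` of degree `D ≥ 1` over `ℂ` that is not
nonsingular is `A · singBaseForm c` for an invertible `A` and some `c` (move a singular point to
`e₀`). [cite: MumfordFogartyKirwan1994, Ch. 4 §2, Prop. 4.2 (proof: singular point at (1,0,…,0))] -/
theorem exists_eq_linSubst_singBaseForm (hD : 1 ≤ D) {G : MvPolynomial (Fin (n + 2)) ℂ}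
    (hG : G.IsHomogeneous D) (hsing : ¬ IsNonsingularForm ℂ G) :
    ∃ (A : Matrix (Fin (n + 2)) (Fin (n + 2)) ℂ) (c : DegIdx (Fin (n + 2)) D → ℂ),
      IsUnit A.det ∧ G = linSubst (Fin (n + 2)) ℂ A (singBaseForm ℂ c) := by
  classical
  rw [isNonsingularForm_iff_forall_exists_eval_pderiv_ne_zero] at hsing
  push Not at hsing
  obtain ⟨z, hz, hGz, hdG⟩ := hsing
  obtain ⟨B, hBdet, hBrow⟩ := exists_matrix_row_zero_eq z hz
  -- `F₀ := B · G` is singular at `e₀` since `Bᵀ e₀ = z`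
  have hBe : Bᵀ *ᵥ Pi.single (0 : Fin (n + 2)) (1 : ℂ) = z := by
    ext k
    rw [Matrix.mulVec, dotProduct_comm, single_dotProduct, one_mul, Matrix.transpose_apply, hBrow k]
  set F₀ := linSubst (Fin (n + 2)) ℂ B G with hF₀_def
  have hF₀ : F₀.IsHomogeneous D := linSubst_isHomogeneous B hG
  have hF₀0 : eval (Pi.single (0 : Fin (n + 2)) (1 : ℂ)) F₀ = 0 := by
    rw [hF₀_def, eval_linSubst_eq, hBe, hGz]
  have hF₀1 : ∀ j, eval (Pi.single (0 : Fin (n + 2)) (1 : ℂ)) (pderiv j F₀) = 0 := by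
    intro j
    rw [hF₀_def, pderiv_linSubst_eq_sum, map_sum]
    refine Finset.sum_eq_zero fun l _ => ?_
    rw [smul_eval, eval_linSubst_eq, hBe, hdG l, mul_zero]
  have hF₀eq := eq_singBaseForm_of_singular_at_single hF₀ hD hF₀0 hF₀1
  -- `G = B⁻¹ · F₀`
  refine ⟨B⁻¹, formCoeff D F₀, ?_, ?_⟩
  · rw [Matrix.det_nonsing_inv]
    exact hBdet.ringInverse
  · rw [← hF₀eq, hF₀_def, ← AlgHom.comp_apply, ← linSubst_mul, Matrix.nonsing_inv_mul _ hBdet,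
      linSubst_one, AlgHom.id_apply]

end Image

/-! ### The universal singular family and the prime ideal of the singular locus -/

section Family

/-- The parameter variables of the singular family: matrix entries `Y_{ij}` and base coefficients
`c_e`. [cite: GelfandKapranovZelevinsky1994, Ch. 1 §1 (the discriminant hypersurface)] -/
abbrev SingVars (n D : ℕ) : Type := (Fin (n + 2) × Fin (n + 2)) ⊕ DegIdx (Fin (n + 2)) D

/-- **The universal singular family**: the degree-`D` coefficients of `Y · singBaseForm c` as
polynomials in the generic matrix `Y` and the generic base coefficients `c` — the comorphism of the
polynomial map `Mat_m × S_{e₀} → Sym^D` onto the singular forms.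
[cite: GelfandKapranovZelevinsky1994, Ch. 1 §1 (the discriminant hypersurface)] -/
def singFamilyCoeff (d : DegIdx (Fin (n + 2)) D) : MvPolynomial (SingVars n D) ℂ :=
  coeff d.1 (linSubst (Fin (n + 2)) (MvPolynomial (SingVars n D) ℂ)
    (Matrix.of fun i j => X (Sum.inl (i, j)))
    (singBaseForm (MvPolynomial (SingVars n D) ℂ) fun e => X (Sum.inr e)))

/-- The point of parameter space with matrix `A` and base coefficients `c`. [cite: MumfordFogartyKirwan1994, Ch. 4 §2, Prop. 4.2 (proof: singular point at (1,0,…,0))] -/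
def singFamilyPt (A : Matrix (Fin (n + 2)) (Fin (n + 2)) ℂ) (c : DegIdx (Fin (n + 2)) D → ℂ) :
    SingVars n D → ℂ :=
  Sum.elim (fun ij => A ij.1 ij.2) c

/-- Base change for `linSubst` (private copy of the tree lemma of `BLMW11HilbertKraftReduction`).
[folklore] -/
private theorem map_linSubst' {σ R S : Type*} [Fintype σ] [CommRing R] [CommRing S] (θ : R →+* S)
    (A : Matrix σ σ R) (p : MvPolynomial σ R) :
    MvPolynomial.map θ (linSubst σ R A p) = linSubst σ S (A.map θ) (MvPolynomial.map θ p) := by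
  change MvPolynomial.map θ (aeval _ p) = aeval _ (MvPolynomial.map θ p)
  rw [aeval_eq_bind₁, aeval_eq_bind₁, map_bind₁]
  congr 2
  funext i
  simp only [map_sum, smul_eq_C_mul, map_mul, map_C, map_X, Matrix.map_apply]

/-- **Specialisation**: at the point `(A, c)` the universal coefficient `d` evaluates to the
`d`-th coefficient of `A · singBaseForm c`. [cite: GelfandKapranovZelevinsky1994, Ch. 1 §1 (the discriminant hypersurface)] -/
theorem eval_singFamilyPt_singFamilyCoeff (A : Matrix (Fin (n + 2)) (Fin (n + 2)) ℂ)
    (c : DegIdx (Fin (n + 2)) D → ℂ) (d : DegIdx (Fin (n + 2)) D) :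
    eval (singFamilyPt A c) (singFamilyCoeff d) =
      coeff d.1 (linSubst (Fin (n + 2)) ℂ A (singBaseForm ℂ c)) := by
  have hA : (Matrix.of fun i j => (X (Sum.inl (i, j)) : MvPolynomial (SingVars n D) ℂ)).map
      (eval (singFamilyPt A c)) = A := by
    ext i j
    rw [Matrix.map_apply, Matrix.of_apply, eval_X]
    rfl
  have hc : (eval (singFamilyPt A c) : MvPolynomial (SingVars n D) ℂ →+* ℂ) ∘
      (fun e : DegIdx (Fin (n + 2)) D => (X (Sum.inr e) : MvPolynomial (SingVars n D) ℂ)) = c := by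
    funext e
    show eval (singFamilyPt A c) (X (Sum.inr e)) = c e
    rw [eval_X]
    rfl
  unfold singFamilyCoeff
  rw [← coeff_map, map_linSubst', map_singBaseForm, hA, hc]

/-- **The vanishing ideal of the singular forms is the kernel of the family's comorphism**: a
polynomial function `Φ` on `Sym^D` (`D ≥ 2`) vanishes at every form that is not nonsingular iff
`Φ(singFamilyCoeff) = 0` identically in `(Y, c)`. (⇒: the pulled-back polynomial vanishes at every
point of the affine parameter space; ⇐: every singular form is a value of the family.)
[cite: GelfandKapranovZelevinsky1994, Ch. 1 §1 (the discriminant hypersurface)] -/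
theorem forall_singular_aeval_eq_zero_iff (hD : 2 ≤ D) (Φ : MvPolynomial (DegIdx (Fin (n + 2)) D) ℂ) :
    (∀ F : MvPolynomial (Fin (n + 2)) ℂ, F.IsHomogeneous D → ¬ IsNonsingularForm ℂ F →
        aeval (formCoeff D F) Φ = 0) ↔
      aeval (R := ℂ) (singFamilyCoeff (n := n) (D := D)) Φ = 0 := by
  classical
  have key : ∀ (A : Matrix (Fin (n + 2)) (Fin (n + 2)) ℂ) (c : DegIdx (Fin (n + 2)) D → ℂ),
      eval (singFamilyPt A c) (aeval (R := ℂ) (singFamilyCoeff (n := n) (D := D)) Φ) =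
        aeval (formCoeff D (linSubst (Fin (n + 2)) ℂ A (singBaseForm ℂ c))) Φ := by
    intro A c
    induction Φ using MvPolynomial.induction_on with
    | C a => simp
    | add p q hp hq => simp only [map_add, hp, hq]
    | mul_X p d hp =>
      simp only [map_mul, hp, aeval_X, eval_singFamilyPt_singFamilyCoeff, formCoeff_apply]
  constructor
  · intro h
    apply MvPolynomial.funext
    intro x
    rw [map_zero]
    -- every point is `singFamilyPt A c`
    obtain ⟨A, c, rfl⟩ : ∃ A c, x = singFamilyPt (n := n) (D := D) A c :=
      ⟨Matrix.of fun i j => x (Sum.inl (i, j)), fun e => x (Sum.inr e), by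
        funext v; rcases v with ⟨⟨i, j⟩⟩ | e <;> rfl⟩
    rw [key]
    exact h _ (linSubst_isHomogeneous A (isHomogeneous_singBaseForm c))
      (not_isNonsingularForm_linSubst_singBaseForm hD A c)
  · intro h F hF hsing
    obtain ⟨A, c, -, rfl⟩ := exists_eq_linSubst_singBaseForm (by omega) hF hsing
    rw [← key, h, map_zero]

/-- **The ideal of the singular locus is prime**: the kernel of the comorphism of the singular
family is a prime ideal of `ℂ[Sym^D ℂ^{n+2}]` (a kernel into a domain) — the singular forms of degree
`D` form an IRREDUCIBLE family. [cite: GelfandKapranovZelevinsky1994, Ch. 1 §1 (the discriminant hypersurface)] -/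
theorem isPrime_ker_singFamily :
    (RingHom.ker (aeval (R := ℂ) (singFamilyCoeff (n := n) (D := D))).toRingHom).IsPrime :=
  RingHom.ker_isPrime _

/-- **The ideal of the singular locus is non-zero** (`D ≥ 2`): the genericity polynomial of
`isZariskiGeneric_isNonsingularForm` (generic forms are nonsingular) is a non-zero member.
[cite: GelfandKapranovZelevinsky1994, Ch. 1 §1 (the discriminant hypersurface)] -/
theorem ker_singFamily_ne_bot (hD : 2 ≤ D) :
    RingHom.ker (aeval (R := ℂ) (singFamilyCoeff (n := n) (D := D))).toRingHom ≠ ⊥ := by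
  obtain ⟨Φ, hΦ0, hΦ⟩ := isZariskiGeneric_isNonsingularForm (n := n) (D := D) (by omega)
  intro hbot
  apply hΦ0
  have hmem : Φ ∈ RingHom.ker (aeval (R := ℂ) (singFamilyCoeff (n := n) (D := D))).toRingHom := by
    rw [RingHom.mem_ker]
    exact (forall_singular_aeval_eq_zero_iff hD Φ).1 fun F hF hsing => by
      by_contra hne
      exact hsing (hΦ F hF hne)
  rw [hbot] at hmem
  exact (Submodule.mem_bot _).1 hmem

end Family

end FormDiscriminant

end Literature.Computability.AlgebraicComplexity

end
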